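import Literature.RingTheory.TightClosure.CartierModule
import Mathlib.Algebra.Module.LocalizedModule.Submodule
import Mathlib.Algebra.CharP.Lemmas
import HarnessLib

/-!
# Cartier modules: restriction of scalars and localisation (Blickle–Böckle 2011, Lemma 2.3)

Topic: `Literature/RingTheory/TightClosure`. Continuation of `CartierModule.lean`, all PROVED:

* `restrictScalars` — a Cartier structure over `R` is one over any `A` with `A → R`
  (`a^q m = (algebraMap a)^q m`);
* `localized S 𝒞` — **the localised Cartier structure** on `M[S⁻¹] = LocalizedModule S M` over
  `R[S⁻¹] = Localization S`: "concretely on a fraction `m/s = m s^(q-1)/s^q` the structural map is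
  given by `C_{S⁻¹M}(m/s) = C_M(m s^(q-1))/s`" (Blickle–Böckle Lemma 2.3), with
  `localized_C_mk`, `localized_C_mk_pow` (`C(n)/s = C_{S⁻¹M}(n/s^q)`);
* `image_localized` / `iterImage_localized` — **the formation of images commutes with
  localisation**: `C_{S⁻¹M}(S⁻¹N) = S⁻¹C(N)`, hence `Cⁿ(S⁻¹M) = S⁻¹Cⁿ(M)` ("`C(S⁻¹M) = C(S^{-q}M) =
  S⁻¹C(M)`", proof of Prop. 2.14), so that nilpotence of `M_x` means `(Cⁿ M)_x = 0` for some `n`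
  (`isNilpotent_localized_iff`) — the identification behind `CartierModule.crysSupport`.

What is NOT here: functoriality in `S`; localisation of Cartier submodule lattices; the sheaf `M̃`.

## Sources

* [BlickleBockle2011] M. Blickle, G. Böckle, *Cartier modules: finiteness results*, J. reine
  angew. Math. 661 (2011) = arXiv:0909.2531 (arXiv numbering, read): Lemma 2.3, proof of Prop. 2.14.
-/

noncomputable section

namespace Literature.RingTheory.TightClosure

universe u v w

namespace CartierModule

variable {p e : ℕ} {R : Type u} {M : Type v} [CommRing R] [AddCommGroup M] [Module R M]

/-! ## Restriction of scalars -/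

/-- A Cartier structure over `R` restricts to one over any `A` mapping to `R`
(`C(a^q m) = C((algebraMap a)^q m) = a C(m)`). [folklore] -/
def restrictScalars (A : Type w) [CommRing A] [Algebra A R] [Module A M] [IsScalarTower A R M]
    (𝒞 : CartierModule p e R M) : CartierModule p e A M where
  C := 𝒞.C
  map_pow_smul' a m := by
    rw [← algebraMap_smul R (a ^ p ^ e) m, map_pow, 𝒞.map_pow_smul, algebraMap_smul]

/-- Restriction of scalars does not change the structural map. [folklore] -/
@[simp]
theorem restrictScalars_C (A : Type w) [CommRing A] [Algebra A R] [Module A M]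
    [IsScalarTower A R M] (𝒞 : CartierModule p e R M) : (𝒞.restrictScalars A).C = 𝒞.C :=
  rfl

/-! ## Localisation -/

section Localization

variable [ExpChar R p] (S : Submonoid R)

/-- `q - 1 + 1 = q` for `q = p^e`. [folklore] -/
theorem pow_sub_one_add_one (R : Type u) [CommRing R] (p e : ℕ) [ExpChar R p] :
    p ^ e - 1 + 1 = p ^ e :=
  Nat.sub_add_cancel (expChar_pow_pos R p e)

/-- The numerator formula `(m, s) ↦ C(s^(q-1) m)/s` respects the localisation relation.
[cite: BlickleBockle2011, Lemma 2.3] -/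
theorem localized_wd (𝒞 : CartierModule p e R M) (a b : M × S) (h : a ≈ b) :
    LocalizedModule.mk (𝒞.C (((a.2 : R) ^ (p ^ e - 1)) • a.1)) a.2 =
      LocalizedModule.mk (𝒞.C (((b.2 : R) ^ (p ^ e - 1)) • b.1)) b.2 := by
  obtain ⟨m, s⟩ := a
  obtain ⟨m', s'⟩ := b
  obtain ⟨u, hu⟩ := h
  refine LocalizedModule.mk_eq.mpr ⟨u, ?_⟩
  dsimp only at hu ⊢
  simp only [Submonoid.smul_def, smul_smul] at hu ⊢
  set q' := p ^ e - 1 with hq'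
  have hq : p ^ e = q' + 1 := (pow_sub_one_add_one R p e).symm
  rw [← 𝒞.map_pow_smul, ← 𝒞.map_pow_smul, smul_smul, smul_smul, hq]
  have h1 : ((u : R) * s') ^ (q' + 1) * (s : R) ^ q' =
      ((u : R) * s') ^ q' * (s : R) ^ q' * ((u : R) * s') := by ring
  have h2 : ((u : R) * s) ^ (q' + 1) * (s' : R) ^ q' =
      ((u : R) * s') ^ q' * (s : R) ^ q' * ((u : R) * s) := by ring
  rw [h1, h2, mul_smul, mul_smul _ ((u : R) * s), hu]

/-- **The localised Cartier structure** on `S⁻¹M` over `S⁻¹R`: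
`C_{S⁻¹M}(m/s) = C(s^(q-1) m)/s` ("since `m/s = m s^(q-1)/s^q`"). [cite: BlickleBockle2011, Lemma 2.3] -/
def localized (𝒞 : CartierModule p e R M) :
    CartierModule p e (Localization S) (LocalizedModule S M) where
  C :=
    { toFun := fun x => x.liftOn
        (fun ms => LocalizedModule.mk (𝒞.C (((ms.2 : R) ^ (p ^ e - 1)) • ms.1)) ms.2)
        (𝒞.localized_wd S)
      map_zero' := by
        rw [← LocalizedModule.zero_mk 1, LocalizedModule.liftOn_mk, smul_zero, map_zero,
          LocalizedModule.zero_mk]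
      map_add' := fun x y => by
        induction x using LocalizedModule.induction_on with
        | h m s =>
          induction y using LocalizedModule.induction_on with
          | h m' s' =>
            rw [LocalizedModule.mk_add_mk, LocalizedModule.liftOn_mk, LocalizedModule.liftOn_mk,
              LocalizedModule.liftOn_mk, LocalizedModule.mk_add_mk]
            refine congrArg₂ LocalizedModule.mk ?_ rfl
            set q' := p ^ e - 1 with hq'
            have hq : p ^ e = q' + 1 := (pow_sub_one_add_one R p e).symm
            simp only [Submonoid.smul_def, Submonoid.coe_mul]
            rw [← 𝒞.map_pow_smul, ← 𝒞.map_pow_smul, ← map_add, smul_add, smul_smul, smul_smul,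
              smul_smul, smul_smul, hq]
            congr 2 <;> ring }
  map_pow_smul' r x := by
    induction x using LocalizedModule.induction_on with
    | h m s =>
      induction r using Localization.induction_on with
      | H y =>
        obtain ⟨a, t⟩ := y
        set q' := p ^ e - 1 with hq'
        have hq : p ^ e = q' + 1 := (pow_sub_one_add_one R p e).symm
        rw [Localization.mk_pow, LocalizedModule.mk_smul_mk]
        simp only [AddMonoidHom.coe_mk, ZeroHom.coe_mk, LocalizedModule.liftOn_mk]
        rw [LocalizedModule.mk_smul_mk, LocalizedModule.mk_eq]
        refine ⟨1, ?_⟩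
        simp only [one_smul, Submonoid.smul_def, Submonoid.coe_mul, SubmonoidClass.coe_pow,
          ← 𝒞.map_pow_smul, smul_smul]
        rw [hq]
        simp only [Nat.add_sub_cancel]
        congr 2
        ring

/-- The localised structural map on fractions: `C_{S⁻¹M}(m/s) = C(s^(q-1) m)/s`.
[cite: BlickleBockle2011, Lemma 2.3] -/
theorem localized_C_mk (𝒞 : CartierModule p e R M) (m : M) (s : S) :
    (𝒞.localized S).C (LocalizedModule.mk m s) =
      LocalizedModule.mk (𝒞.C (((s : R) ^ (p ^ e - 1)) • m)) s :=
  LocalizedModule.liftOn_mk (𝒞.localized_wd S) m s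

/-- On fractions with denominator `1`: `C_{S⁻¹M}(m/1) = C(m)/1` (the localisation map is Cartier
linear). [cite: BlickleBockle2011, Lemma 2.3] -/
theorem localized_C_mk_one (𝒞 : CartierModule p e R M) (m : M) :
    (𝒞.localized S).C (LocalizedModule.mk m 1) = LocalizedModule.mk (𝒞.C m) 1 := by
  rw [localized_C_mk, Submonoid.coe_one, one_pow, one_smul]

/-- `C(n)/s = C_{S⁻¹M}(n/s^q)`. [cite: BlickleBockle2011, Lemma 2.3 ("`m/s = m s^(q-1)/s^q`")] -/
theorem localized_C_mk_pow (𝒞 : CartierModule p e R M) (n : M) (s : S) :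
    (𝒞.localized S).C (LocalizedModule.mk n (s ^ p ^ e)) = LocalizedModule.mk (𝒞.C n) s := by
  rw [localized_C_mk, LocalizedModule.mk_eq]
  refine ⟨1, ?_⟩
  set q' := p ^ e - 1 with hq'
  have hq : p ^ e = q' + 1 := (pow_sub_one_add_one R p e).symm
  simp only [one_smul, Submonoid.smul_def, SubmonoidClass.coe_pow]
  rw [← 𝒞.map_pow_smul, ← 𝒞.map_pow_smul, smul_smul, hq]
  congr 2
  ring

/-- **Images commute with localisation**: `C_{S⁻¹M}(S⁻¹N) = S⁻¹ C(N)`.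
[cite: BlickleBockle2011, proof of Prop. 2.14 ("`C(S⁻¹M) = C(S^{-q}M) = S⁻¹C(M)`")] -/
theorem image_localized (𝒞 : CartierModule p e R M) (N : Submodule R M) :
    (𝒞.localized S).image (N.localized S) = (𝒞.image N).localized S := by
  ext x
  rw [mem_image_iff, Submodule.mem_localized']
  constructor
  · rintro ⟨y, hy, rfl⟩
    obtain ⟨n, hn, s, rfl⟩ := (Submodule.mem_localized' _ _ _ _ _).mp hy
    refine ⟨_, 𝒞.apply_mem_image (N.smul_mem ((s : R) ^ (p ^ e - 1)) hn), s, ?_⟩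
    rw [← IsLocalizedModule.mk_eq_mk', ← IsLocalizedModule.mk_eq_mk', localized_C_mk]
  · rintro ⟨_, hy, s, rfl⟩
    obtain ⟨n, hn, rfl⟩ := mem_image_iff.mp hy
    refine ⟨LocalizedModule.mk n (s ^ p ^ e), ?_, ?_⟩
    · exact (Submodule.mem_localized' _ _ _ _ _).mpr ⟨n, hn, s ^ p ^ e, (IsLocalizedModule.mk_eq_mk' _ _).symm⟩
    · rw [← IsLocalizedModule.mk_eq_mk', localized_C_mk_pow]

/-- **Iterated images commute with localisation**: `Cⁿ(S⁻¹M) = S⁻¹ Cⁿ(M)`.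
[cite: BlickleBockle2011, proof of Prop. 2.14] -/
theorem iterImage_localized (𝒞 : CartierModule p e R M) (n : ℕ) (N : Submodule R M) :
    (𝒞.localized S).iterImage n (N.localized S) = (𝒞.iterImage n N).localized S := by
  induction n with
  | zero => rfl
  | succ n ih => rw [iterImage_succ, iterImage_succ, ih, image_localized]

/-- In particular `Cⁿ(S⁻¹M) = S⁻¹ Cⁿ(M)` for the whole module. [cite: BlickleBockle2011, proof of
Prop. 2.14] -/
theorem iterImage_localized_top (𝒞 : CartierModule p e R M) (n : ℕ) :
    (𝒞.localized S).iterImage n ⊤ = (𝒞.iterImage n ⊤).localized S := by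
  rw [← 𝒞.iterImage_localized S n ⊤]
  exact congrArg _ (Submodule.localized'_top _ _ _).symm

/-- **`S⁻¹M` is nilpotent iff `S⁻¹Cⁿ(M) = 0` for some `n`**, i.e. (for `Cⁿ(M)` finitely generated)
iff some `s ∈ S` kills `Cⁿ(M)`; at a prime `x` this says: `M_x` is nilpotent iff `x ∉ Supp Cⁿ(M)`
for some `n` — the description used for `CartierModule.crysSupport`. [cite: BlickleBockle2011,
Def. 3.15 and Lemma 2.10] -/
theorem isNilpotent_localized_iff (𝒞 : CartierModule p e R M) :
    (𝒞.localized S).IsNilpotent ↔ ∃ n, (𝒞.iterImage n ⊤).localized S = ⊥ := by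
  refine exists_congr fun n => ?_
  rw [iterImage_localized_top]

end Localization

end CartierModule

end Literature.RingTheory.TightClosure

end
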